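import Mathlib
import Literature.Analysis.FluidPDE.PineauVicolAngularMean
import Literature.Analysis.FluidPDE.AxisymPoloidalPart
import Literature.Analysis.FluidPDE.AxisymmetricVorticityTransport
import HarnessLib.Audit
import HarnessLib

/-!
# L3TimeExponentPincer — an a.e.-axisymmetric, a.e.-swirl-free field has an exactly symmetric representative

Support kernel for the crux `L3CascadeJaw` (item stmt-NavierStokesRegularity-19499) of route
`L3TimeExponentPincer`, on the path `(SFL³-mild) ⇒ CritSmoothingNoSwirlB` of planner nsreg-p2's
ROUND-12: the compactness step (J) delivers the symmetry of the limit datum only ALMOST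
EVERYWHERE and angle by angle (`∀ θ, a.e. x`), while Kato's theory in the axisymmetric class
(`…AxisymmetricKatoGlobal…`, `…L3TimeExponentPincerNoSwirlKatoGlobal`) is phrased with the
pointwise predicates `IsAxisymmetric`, `HasNoSwirl`.  Since Kato's class only sees the datum up to
a null set, it suffices to SYMMETRISE the representative:

* `angularMeanVec_ae_eq` — if `v` is a.e.-strongly measurable and, for every angle `θ`,
  `v (R_θ x) = R_θ (v x)` for a.e. `x`, then the angular mean `⟨v⟩_θ`
  (`angularMeanVec`, Pineau–Vicol 2026 (6.4): `(2π)⁻¹ ∫₀^{2π} R_{−θ} v(R_θ x) dθ`, an EXACTLY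
  axisymmetric field for any `v`, `isAxisymmetric_angularMeanVec`) agrees with `v` a.e.
  (Fubini on `ℝ × ℝ³`: `Measure.ae_ae_comm`, then the integrand is a.e. constant in `θ`);
* `exists_isAxisymmetric_hasNoSwirl_ae_eq` — if moreover the swirl `x₀ v₁ − x₁ v₀` vanishes a.e.,
  the poloidal part of the angular mean (`poloidalPart`, Seregin–Zajaczkowski's `V − V_φ e_φ`:
  exactly swirl-free, `hasNoSwirl_poloidalPart`, and axisymmetric, `poloidalPart_rotZ`) is a
  representative of `v` which is pointwise axisymmetric and swirl-free.

WHAT THIS IS NOT: not NS — measure theory (Fubini) over the tree's angular-mean and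
poloidal-part algebra; the crux `L3CascadeJaw` is untouched; no crux claim.
-/

noncomputable section

open Set MeasureTheory Filter Topology Function Metric TopologicalSpace
open scoped ENNReal NNReal Real
open Literature.Analysis.FluidPDE

namespace Summit.NavierStokesRegularity.NavierStokesRegularity.Theorems.L3TimeExponentPincerAxisymmetricRepresentative

/-- Transport of the a.e. equivariance to a strongly measurable representative, in conjugated
form: if `v (R_θ x) = R_θ (v x)` a.e. and `vm = v` a.e., then `R_{-θ} (vm (R_θ x)) = vm x` a.e. -/
theorem ae_conj_eq_of_ae_eq {v vm : EuclideanSpace ℝ (Fin 3) → EuclideanSpace ℝ (Fin 3)} {θ : ℝ}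
    (hax : ∀ᵐ x ∂volume, v (rotZ θ x) = rotZ θ (v x)) (hvm : v =ᵐ[volume] vm) :
    ∀ᵐ x ∂volume, rotZ (-θ) (vm (rotZ θ x)) = vm x := by
  have h1 : ∀ᵐ x ∂volume, v (rotZ θ x) = vm (rotZ θ x) :=
    (rotZLIE θ).measurePreserving.quasiMeasurePreserving.ae_eq hvm
  filter_upwards [hax, hvm, h1] with x hx hxv hx1
  rw [← hx1, hx, ← rotZ_add, neg_add_cancel, rotZ_zero, hxv]

/-- Joint measurability of `(θ, x) ↦ vm (R_θ x)` for a measurable `vm`. -/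
theorem measurable_comp_rotZ_uncurry {vm : EuclideanSpace ℝ (Fin 3) → EuclideanSpace ℝ (Fin 3)}
    (hvm : Measurable vm) :
    Measurable fun p : ℝ × EuclideanSpace ℝ (Fin 3) => vm (rotZ p.1 p.2) :=
  hvm.comp continuous_rotZ_uncurry'.measurable

/-- Measurability of `(θ, x) ↦ (-θ, vm (R_θ x))`. -/
theorem measurable_neg_prodMk_comp_rotZ {vm : EuclideanSpace ℝ (Fin 3) → EuclideanSpace ℝ (Fin 3)}
    (hvm : Measurable vm) :
    Measurable fun p : ℝ × EuclideanSpace ℝ (Fin 3) => ((-p.1 : ℝ), vm (rotZ p.1 p.2)) :=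
  measurable_fst.neg.prodMk (measurable_comp_rotZ_uncurry hvm)

/-- Joint measurability of `(θ, x) ↦ R_{-θ} (vm (R_θ x))` for a measurable `vm`. -/
theorem measurable_conj_rotZ {vm : EuclideanSpace ℝ (Fin 3) → EuclideanSpace ℝ (Fin 3)}
    (hvm : Measurable vm) :
    Measurable fun p : ℝ × EuclideanSpace ℝ (Fin 3) => rotZ (-p.1) (vm (rotZ p.1 p.2)) := by
  have h := (continuous_rotZ_uncurry'.measurable).comp (measurable_neg_prodMk_comp_rotZ hvm)
  exact h

/-- **The angular mean of an a.e.-axisymmetric field is a representative of it.**  If `v` is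
a.e.-strongly measurable and for every angle `θ`, `v (R_θ x) = R_θ (v x)` for a.e. `x`, then
`angularMeanVec vm = v` a.e. for the strongly measurable representative `vm` of `v` — and hence for
some exactly axisymmetric field.  (Fubini: for a.e. `x` the integrand `R_{-θ} vm(R_θ x)` equals
`vm x` for a.e. `θ`, so its average over `[0, 2π]` is `vm x`.) -/
theorem angularMeanVec_ae_eq {v : EuclideanSpace ℝ (Fin 3) → EuclideanSpace ℝ (Fin 3)}
    (hv : AEStronglyMeasurable v volume)
    (hax : ∀ θ : ℝ, ∀ᵐ x ∂volume, v (rotZ θ x) = rotZ θ (v x)) :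
    angularMeanVec (hv.mk v) =ᵐ[volume] v := by
  set vm := hv.mk v with hvm_def
  have hvm_sm : StronglyMeasurable vm := hv.stronglyMeasurable_mk
  have hv_vm : v =ᵐ[volume] vm := hv.ae_eq_mk
  -- for every angle, a.e. in `x`
  have h1 : ∀ θ : ℝ, ∀ᵐ x ∂volume, rotZ (-θ) (vm (rotZ θ x)) = vm x := fun θ =>
    ae_conj_eq_of_ae_eq (hax θ) hv_vm
  -- Fubini: a.e. in `x`, a.e. in `θ`
  have hmeas : MeasurableSet {p : ℝ × EuclideanSpace ℝ (Fin 3) |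
      rotZ (-p.1) (vm (rotZ p.1 p.2)) = vm p.2} :=
    measurableSet_eq_fun (measurable_conj_rotZ hvm_sm.measurable) (hvm_sm.measurable.comp measurable_snd)
  have h2 : ∀ᵐ x ∂(volume : Measure (EuclideanSpace ℝ (Fin 3))), ∀ᵐ θ ∂(volume : Measure ℝ),
      rotZ (-θ) (vm (rotZ θ x)) = vm x :=
    (Measure.ae_ae_comm (μ := (volume : Measure ℝ))
      (ν := (volume : Measure (EuclideanSpace ℝ (Fin 3))))
      (p := fun θ x => rotZ (-θ) (vm (rotZ θ x)) = vm x) hmeas).1 (Eventually.of_forall h1)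
  -- the average of an a.e.-constant integrand
  filter_upwards [h2, hv_vm] with x hx hxv
  rw [angularMeanVec_apply]
  have hint : ∫ θ in (0 : ℝ)..2 * π, rotZ (-θ) (vm (rotZ θ x)) = ∫ θ in (0 : ℝ)..2 * π, vm x :=
    intervalIntegral.integral_congr_ae (hx.mono fun θ hθ _ => hθ)
  rw [hint, intervalIntegral.integral_const, smul_smul, sub_zero,
    inv_mul_cancel₀ (by positivity : (2 : ℝ) * π ≠ 0), one_smul, hxv]

/-- **An a.e.-axisymmetric field has an exactly axisymmetric representative.** -/
theorem exists_isAxisymmetric_ae_eq {v : EuclideanSpace ℝ (Fin 3) → EuclideanSpace ℝ (Fin 3)}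
    (hv : AEStronglyMeasurable v volume)
    (hax : ∀ θ : ℝ, ∀ᵐ x ∂volume, v (rotZ θ x) = rotZ θ (v x)) :
    ∃ w : EuclideanSpace ℝ (Fin 3) → EuclideanSpace ℝ (Fin 3), w =ᵐ[volume] v ∧ IsAxisymmetric w :=
  ⟨angularMeanVec (hv.mk v), angularMeanVec_ae_eq hv hax, isAxisymmetric_angularMeanVec _⟩

/-- The swirl at `x` only depends on the value at `x`. -/
theorem swirl_congr {w v : EuclideanSpace ℝ (Fin 3) → EuclideanSpace ℝ (Fin 3)}
    {x : EuclideanSpace ℝ (Fin 3)} (h : w x = v x) : swirl w x = swirl v x := by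
  simp only [swirl, h]

/-- **An a.e.-axisymmetric, a.e.-swirl-free field has an exactly axisymmetric swirl-free
representative**: the poloidal part of the angular mean of its strongly measurable
representative. -/
theorem exists_isAxisymmetric_hasNoSwirl_ae_eq
    {v : EuclideanSpace ℝ (Fin 3) → EuclideanSpace ℝ (Fin 3)} (hv : AEStronglyMeasurable v volume)
    (hax : ∀ θ : ℝ, ∀ᵐ x ∂volume, v (rotZ θ x) = rotZ θ (v x))
    (hsw : ∀ᵐ x ∂volume, swirl v x = 0) :
    ∃ w : EuclideanSpace ℝ (Fin 3) → EuclideanSpace ℝ (Fin 3),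
      w =ᵐ[volume] v ∧ IsAxisymmetric w ∧ HasNoSwirl w := by
  obtain ⟨wa, hwa, haxa⟩ := exists_isAxisymmetric_ae_eq hv hax
  refine ⟨poloidalPart wa, ?_, fun θ x => poloidalPart_rotZ (haxa θ x), hasNoSwirl_poloidalPart wa⟩
  filter_upwards [hwa, hsw] with x hx hxs
  have h0 : swirl wa x = 0 := by rw [swirl_congr hx, hxs]
  rw [poloidalPart_eq_sub_smul_rotGen, h0, zero_div, zero_smul, sub_zero, hx]

end Summit.NavierStokesRegularity.NavierStokesRegularity.Theorems.L3TimeExponentPincerAxisymmetricRepresentative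

end
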